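import Summits.QuantumFields.YangMills.Theses.ThermalTraceWindow
import Summits.QuantumFields.YangMills.Theorems.LuscherReductionRunningReductionTraceFormula
import Summits.QuantumFields.YangMills.Theorems.FemtoTransferGapBounds
import Summits.QuantumFields.YangMills.Theorems.FemtoTransferGapPositivity
import Summits.QuantumFields.YangMills.Theorems.FemtoTransferGapLevelsDecay
import HarnessLib

/-!
# `ThermalTraceWindow.TwoLevelPopulation` (item stmt-QuantumFields-28292, support K2b of LINE g8-B) — PROVED

Two populated zero-flux transfer levels depress the dyadic thermal trace ratio: for `β ≥ 1`, `L ≥ 2`,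
`Z_phys(2L×L³) ≤ (1 − x/2) · Z_phys(L×L³)²` with `x = (λ₁/λ₀)^L ∈ [0,1]` (`λ_k = levelValue su2Rep L β k`,
`Z_phys = TT.physTrace`). Finite algebra over the PROVED trace formula `TT.traceFormula_all` (`Σ_k λ_k^T = Z_phys(T)`),
non-negativity (`levelValue_nonneg_of_qform_nonneg`) and monotonicity of the levels (`levelValue_le_of_le`):
`Σ a_k² ≤ a₀ Σ a_k ≤ (1 − a₁/(2a₀)) (Σ a_k)²` because `Σ a_k ≥ a₀ + a₁` (`a_k = λ_k^L`).

HONEST FRAMING: fixed-lattice spectral bookkeeping for route `ThermalTraceWindow` (D-0145 LINE of seat ym-idea-4, rung R2ξ″);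
no RG content, no window, no summit.
-/

open Literature.MathematicalPhysics.QuantumLattice
open Summit.QuantumFields.YangMills.Theorems
open Summit.QuantumFields.YangMills.Theorems.FemtoTransferGap

namespace Summit.QuantumFields.YangMills.Theses.ThermalTraceWindow

/-- **K2b holds** (item stmt-QuantumFields-28292). -/
theorem twoLevelPopulation_holds : TwoLevelPopulation := by
  intro L _ β hβ hL
  have hβpos : 0 < β := by linarith
  set lam : ℕ → ℝ := fun j => levelValue su2Rep L β j with hlam
  have hlam0 : 0 < lam 0 := levelValue_zero_su2Rep_pos L β
  have hnn : ∀ j, 0 ≤ lam j := fun j =>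
    levelValue_nonneg_of_qform_nonneg su2Rep β (fun ψ hψ => qform_su2Rep_self_nonneg hβpos.le hψ) j
  have hmono : ∀ j, lam j ≤ lam 0 := fun j => levelValue_le_of_le hβpos (Nat.zero_le j)
  have h10 : lam 1 ≤ lam 0 := hmono 1
  -- trace formula
  have hS := TT.traceFormula_all L β L hβ hL            -- HasSum (lam k ^ L) Z(L)
  have hS2 := TT.traceFormula_all L β (2 * L) hβ (by omega)
  set S := TT.physTrace L β L with hSdef
  set S2 := TT.physTrace L β (2 * L) with hS2def
  set a0 := lam 0 ^ L with ha0
  set a1 := lam 1 ^ L with ha1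
  have ha0pos : 0 < a0 := pow_pos hlam0 _
  have ha1nn : 0 ≤ a1 := pow_nonneg (hnn 1) _
  have ha10 : a1 ≤ a0 := pow_le_pow_left₀ (hnn 1) h10 L
  -- Σ a_k² ≤ a0 · S
  have hterm : ∀ j, lam j ^ (2 * L) ≤ a0 * lam j ^ L := by
    intro j
    have : lam j ^ (2 * L) = lam j ^ L * lam j ^ L := by rw [two_mul, pow_add]
    rw [this]
    exact mul_le_mul_of_nonneg_right (pow_le_pow_left₀ (hnn j) (hmono j) L) (pow_nonneg (hnn j) _)
  have hS2le : S2 ≤ a0 * S := hasSum_le hterm hS2 (hS.mul_left a0)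
  -- S ≥ a0 + a1
  have hSge : a0 + a1 ≤ S := by
    have h := sum_le_hasSum (Finset.range 2) (fun j _ => pow_nonneg (hnn j) L) hS
    simpa [Finset.sum_range_succ, ha0, ha1] using h
  have hSpos : 0 < S := by linarith
  -- x = (λ₁/λ₀)^L = a1/a0 ∈ [0,1]
  have hx : (levelValue su2Rep L β 1 / levelValue su2Rep L β 0) ^ L = a1 / a0 := by
    rw [div_pow]
  rw [hx]
  have hx0 : 0 ≤ a1 / a0 := div_nonneg ha1nn ha0pos.le
  have hx1 : a1 / a0 ≤ 1 := (div_le_one ha0pos).mpr ha10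
  -- a0 ≤ (1 - x/2) S
  have hkey : a0 ≤ (1 - a1 / a0 / 2) * S := by
    have h1 : (1 - a1 / a0 / 2) * (a0 + a1) ≤ (1 - a1 / a0 / 2) * S :=
      mul_le_mul_of_nonneg_left hSge (by linarith)
    have h2 : a0 ≤ (1 - a1 / a0 / 2) * (a0 + a1) := by
      have h3 : (1 - a1 / a0 / 2) * (a0 + a1) = a0 + a1 / 2 - a1 * a1 / (2 * a0) := by
        field_simp
        ring
      rw [h3]
      have h4 : a1 * a1 / (2 * a0) ≤ a1 / 2 := by
        rw [div_le_div_iff₀ (by positivity) (by norm_num)]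
        nlinarith
      linarith
    exact h2.trans h1
  calc S2 ≤ a0 * S := hS2le
    _ ≤ ((1 - a1 / a0 / 2) * S) * S := mul_le_mul_of_nonneg_right hkey hSpos.le
    _ = (1 - a1 / a0 / 2) * S ^ 2 := by ring


end Summit.QuantumFields.YangMills.Theses.ThermalTraceWindow
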